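import Mathlib
import Literature.Computability.AlgebraicComplexity.DetReprEquivalent
import Literature.Computability.AlgebraicComplexity.LRPencilOfMatrix
import Summits.ValiantsHypothesis.ValiantsHypothesis.Theorems.SchenstedIndexPowTraceCertificateTools
import HarnessLib

/-!
# Crux `OrbitDimensionBound` (stmt-ValiantsHypothesis-16133), line `affine_multiple`, stub `stub_absorbingSacrifice`
# — piece (β3), tools: index bookkeeping, variables of a linear form, rescaling

Small route-independent lemmas for `…StubAbsorbingSacrificeTerminal.lean` (piece (β3) of the lead's split SPEC
`HOME/lmr/SPEC-p6g11-16133-stub2-split.md`); `--supports stmt-ValiantsHypothesis-16133 --as helper`;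
0 definitions / 0 named facts:
* `natAdd_ne_castAdd` — sacrificed and free indices never coincide;
* `coeff_single_ne_zero_of_mem_vars` — in a linear form an occurring variable has a non-zero coefficient;
* `exists_rescale_C` — an equivariant representation of `C c · f` (`c ≠ 0`, size `≥ 1`) gives one of `f`
  (the line's `Multiple.exists_rescale`, which lives in a `Cruxes/` file, re-proved).

Honest framing: plumbing; `stub_absorbingSacrifice`, the crux and `VP ≠ VNP` remain OPEN.
-/

set_option linter.dupNamespace false
set_option autoImplicit false

noncomputable section

namespace Summit.ValiantsHypothesis.ValiantsHypothesis.Theorems.FreeSubtorusOrbitDimensionBound.AbsorbingSacrifice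

open Literature.Computability.AlgebraicComplexity MvPolynomial Finset

/-! ### Small bookkeeping -/

/-- Sacrificed indices (`Fin.natAdd`) and free indices (`Fin.castAdd`) never coincide. [folklore] -/
theorem natAdd_ne_castAdd {n' s : ℕ} (k : Fin n') (j : Fin s) : Fin.natAdd n' j ≠ Fin.castAdd s k := by
  intro h
  have := congrArg Fin.val h
  simp only [Fin.val_natAdd, Fin.val_castAdd] at this
  omega

/-- In a linear form, a variable that occurs has a non-zero coefficient. [folklore] -/
theorem coeff_single_ne_zero_of_mem_vars {σ : Type*} [Fintype σ] [DecidableEq σ]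
    {q : MvPolynomial σ ℂ} (hq : q.IsHomogeneous 1) {p : σ} (hp : p ∈ q.vars) :
    coeff (Finsupp.single p 1) q ≠ 0 := by
  have hp' := hp
  rw [Theorems.SchenstedIndex.eq_sum_coeff_single_mul_X hq] at hp'
  obtain ⟨v, -, hv⟩ := Finset.mem_biUnion.1 (vars_sum_subset _ _ hp')
  by_cases hc : coeff (Finsupp.single v 1) q = 0
  · rw [hc, C_0, zero_mul, vars_0] at hv
    exact absurd hv (Finset.notMem_empty _)
  · have hsub := vars_mul (C (coeff (Finsupp.single v 1) q)) (X v : MvPolynomial σ ℂ) hv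
    rw [vars_C, Finset.empty_union, vars_X, Finset.mem_singleton] at hsub
    rw [hsub]
    exact hc

/-- **Rescaling a constant away** (the line's `Multiple.exists_rescale`, which lives in a `Cruxes/`
file and is therefore re-proved here): an equivariant representation of `C c · f`, `c ≠ 0`, of size
`m ≥ 1` gives one of `f` (divide one row by `c`; lifts are conjugated). [folklore] -/
theorem exists_rescale_C {n m : ℕ} {Γ : Subgroup (GL (Fin n × Fin n) ℂ)} {f : MvPolynomial (Fin n × Fin n) ℂ}
    {c : ℂ} (hc : c ≠ 0) {B : Matrix (Fin m) (Fin m) (MvPolynomial (Fin n × Fin n) ℂ)}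
    (hB : IsEquivariantDetRepr Γ (C c * f) B) (hm : 1 ≤ m) :
    ∃ B' : Matrix (Fin m) (Fin m) (MvPolynomial (Fin n × Fin n) ℂ), IsEquivariantDetRepr Γ f B' := by
  classical
  set i₀ : Fin m := ⟨0, hm⟩
  set d : Fin m → ℂ := fun i => if i = i₀ then c⁻¹ else 1 with hd
  have hdet : (Matrix.diagonal d).det ≠ 0 := by
    rw [Matrix.det_diagonal]
    refine Finset.prod_ne_zero_iff.2 fun i _ => ?_
    by_cases h : i = i₀
    · simp [hd, h, hc]
    · simp [hd, h]
  set P : GL (Fin m) ℂ := Matrix.GeneralLinearGroup.mkOfDetNeZero (Matrix.diagonal d) hdet with hP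
  set B' : Matrix (Fin m) (Fin m) (MvPolynomial (Fin n × Fin n) ℂ) :=
    (P : Matrix (Fin m) (Fin m) ℂ).map C * B * ((1 : GL (Fin m) ℂ) : Matrix (Fin m) (Fin m) ℂ).map C with hB'
  have hequiv : DetReprEquivalent Γ B B' := detReprEquivalent_mul_mul Γ B P 1
  have hB₁ := isEquivariantDetRepr_iff_exists_mul_mul.1 hB
  refine ⟨B', isEquivariantDetRepr_iff_exists_mul_mul.2 ⟨⟨hequiv.totalDegree_le hB₁.1.1, ?_⟩,
    hequiv.forall_exists_lift hB₁.2⟩⟩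
  have hPdet : ((P : Matrix (Fin m) (Fin m) ℂ).map C : Matrix (Fin m) (Fin m) (MvPolynomial (Fin n × Fin n) ℂ)).det
      = C c⁻¹ := by
    have h1 : (P : Matrix (Fin m) (Fin m) ℂ) = Matrix.diagonal d := rfl
    rw [h1, ← RingHom.mapMatrix_apply, ← RingHom.map_det, Matrix.det_diagonal]
    congr 1
    rw [Finset.prod_eq_single i₀]
    · simp [hd]
    · intro i _ hi; simp [hd, hi]
    · intro h; exact absurd (Finset.mem_univ _) h
  rw [hB', Matrix.det_mul, Matrix.det_mul, hPdet, hB.1.2]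
  simp only [Units.val_one, Matrix.map_one C C_0 C_1, Matrix.det_one, mul_one]
  rw [← mul_assoc, ← C_mul, inv_mul_cancel₀ hc, C_1, one_mul]

end Summit.ValiantsHypothesis.ValiantsHypothesis.Theorems.FreeSubtorusOrbitDimensionBound.AbsorbingSacrifice

end
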